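import Summits.ValiantsHypothesis.ValiantsHypothesis.Theorems.DefinabilityGapClusterMerging
import HarnessLib

/-!
# DefinabilityGap — ROOTED-FOREST MULTISET SUMS: `G_m` hits every forest sum, every fan-in `k`

Route `route-ValiantsHypothesis-DefinabilityGap` (decomp-valiant, lens 5: hardness–randomness / PIT axis); width
road of the read-once leaf F4 / W10 (`KIPlantedHittingRO`, stmt-ValiantsHypothesis-23704, aside), on top of
`DefinabilityGapClusterMerging` BY NAME. `φ = bind₁ (kiPer m)`, `φ_L = bind₁ (wordPoly ∘ wordL L)`.
ELEMENTARY · NEW-COMBINATION · 0 S-currency · closes NO item · K1 / stmt-23704 / VP ≠ VNP untouched.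

## The statement (`kiPer_hits_forestSums`, `kiPer_hits_forestSums_eventually`)

Blocks `B := Fin 3 → Fin (qOf m)` (spelled out). Fix ANY map `par : B → B` and ANY `rk : B → ℕ`; a CHILD is a block
`x` with `rk (par x) < rk x`; a GATE is any MULTISET `E` of children and `tprod par E := Π_{x ∈ E} (z_x − z_{par x})`
(multiplicity = power). For every `k`, every `m` with `2·3^k < m²`, every family `𝓔` of `≤ k` child-multisets and
all coefficients `α`: `φ (Σ_{E ∈ 𝓔} α_E · tprod par E) ≠ 0` unless the sum is `0` — multiplicities, gate degrees and
the number of blocks unbounded. DICTIONARY (prose only): a depth-3 graphical circuit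
`Σ_{i ≤ k} α_i Π_e (z_a − z_b)^{μ_{i,e}}` whose UNION SUPPORT IS A FOREST is such a sum — root each tree, `par` :=
parent, `rk` := depth, an edge `{a, b}` with child `b` ↦ the child `b`, `(z_a − z_b)^μ = (−1)^μ (z_b − z_{par b})^μ`
with the signs moved into `α_i`; distinct edge-multisets give distinct child-multisets. NON-VACUITY: the family
decided here contains `(z_x − z_p)^n` for every `n`, Fermat / diagonal sums `Σ_i α_i (z_{a_i} − z_{b_i})^{n_i}` over
a matching, stars `Σ_i α_i Π_t (z_a − z_{c_t})^{μ_{i,t}}`, paths and caterpillars — repeated AND adjacent edges —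
and `hf` is satisfiable (one gate with a nonzero coefficient is a nonzero sum in the domain `ℂ[z]`).

## Mechanism (`bind₁_wordL_forestSum_ne_zero`: induction on the number of gates, over ALL merge lists)

Merge lists `L` with pairwise distinct merged-away labels (`L.Pairwise (·.2 ≠ ·.2)`; no vertex-disjointness, no
representatives, no support rung); `y` is live iff `y ∉ {p.2 : p ∈ L}`; threshold `2·3^{|L|+j} < m²` for `≤ j`
gates. Five moves. TERM-RANK SELECTION: two distinct gates differ in the count of some child `x₀` (`Multiset.ext`);
`μ` := the minimum count of `x₀` over the gates, `A` := the gates attaining it (`∅ ≠ A ⊊ I`). STRIP: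
`E = replicate μ x₀ + E'` for every gate (`eq_replicate_add`, `tprod_eq_pow_mul`), so the sum is
`(z_{x₀} − z_{par x₀})^μ · S'` and the power survives `φ_L` (`bind₁_wordL_tprod_ne_zero` ← `card_differ_wordL_lt`,
`wordPoly_ne_of_differ_le`: two different live labels have word defects `≤ 3^{|L|} − 1` and `2·3^{|L|} < m²`).
MERGE / TRANSFER: `L' := (par x₀, x₀) :: L` and `φ_{L'} S' ≠ 0 ⟹ φ_L S' ≠ 0` (`bind₁_wordL_ne_zero_of_cons` ←
`rename_mergeSub_bind₁_wordL`). KILL: a gate outside `A` still contains the child `x₀`, whose factor becomes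
`Q'_{x₀} − Q'_{par x₀} = 0` (`bind₁_wordL_tprod_eq_zero` ← `wordL_snd_eq`, i.e. `patch_apply_self` / `patch_apply_left`
on the head pair of `wordL_cons`). CONTRACT: on `A` every factor `z_y − z_{x₀}` reads `Q'_y − Q'_{par x₀}`, so the
gate is the SAME child-multiset under `par' y := if par y = x₀ then par x₀ else par y` (`bind₁_wordL_tprod_congr`);
induct at `(j, L', par', A, E')` with the threshold invariant (`|L'| + j = |L| + (j+1)`). TOP: `L = []`
(`wordL_nil` / `wordL_cons` definitionally, `kiPer_eq_wordPoly`), gates with `α ≠ 0` (`Finset.sum_filter_of_ne`).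

WHY-FOREST. The child hypothesis `hE` / `rk` is used in exactly two places: in BASE / STRIP it gives `x ≠ par x`,
so every factor compares two DIFFERENT live labels; in CONTRACT it keeps `par'` a child map
(`rk (par x₀) < rk x₀ = rk (par y) < rk y` when `par y = x₀`), so the induction never manufactures a factor
`z_y − z_y`. On a union support with a cycle some vertex would need two parents and no `par` exists — that is where
the formal cancellations live. Because gates are multisets of CHILDREN and the merged child `x₀` occurs only in gates
that die, the surviving gates are literally the same child-multisets: distinctness and multiplicities are inherited,
with no orientation signs and no injectivity-of-contraction lemma.

## Where this sits

HONEST BOUNDARY: 0 S-currency; closes NO item; the theorem decides the planted generator G_m against sums of ≤ k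
ROOTED-FOREST (child–parent) multiset products once 2·3^k < m² — multiplicities, gate degrees and the number of
blocks unbounded — and nothing else; it is INCOMPARABLE with DefinabilityGapMatchingSums (a union of matchings may
contain a cycle; a forest product may repeat or chain edges); graphical multisets whose union support contains a
CYCLE (where a vertex needs two parents: the K₄ three-matching identity Δ₁₂,₃₄ − Δ₁₃,₂₄ + Δ₁₄,₂₃ = 0, the triangle
identities x + y + w = 0 and x³ + y³ + w³ = 3xyw for x = z_a − z_b, y = z_b − z_c, w = z_c − z_a), non-graphical
AFFINE ΣΠΣ(k), the LEAF REGIME w = q^b ≫ m and fan-in k growing past 2·3^k < m² are NOT claimed; K1 / stmt-23704 /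
VP ≠ VNP untouched.
Print context: the z-side move is the fan-in induction modulo a linear form with multiplicity stripping of
Dvir–Shpilka / Kayal–Saxena / Saxena–Seshadhri for FORMAL `ΣΠΣ(k)` identities; here the quotient is realized
seed-side by one child→parent merge per round under the fixed planted map. BY-NAME reuse, no re-proofs, no edits of
tree files: `wordL`, `wordL_nil` / `wordL_cons`, `wordL_snd_eq`, `rename_mergeSub_bind₁_wordL`, `card_differ_wordL_lt`
(`DefinabilityGapClusterMerging`), `wordPoly_ne_of_differ_le` (`DefinabilityGapMergeIsolation`), `kiPer_eq_wordPoly`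
(`DefinabilityGapBlockMerging`), `patch_apply_self` / `patch_apply_left` (through `wordL_snd_eq`).
-/

noncomputable section

open MvPolynomial
open Literature.Computability.AlgebraicComplexity Literature.Computability.MetaComplexity
open Summit.ValiantsHypothesis.ValiantsHypothesis.Theorems.DefinabilityGapAffineRung
open Summit.ValiantsHypothesis.ValiantsHypothesis.Theorems.DefinabilityGapBlockMerging
open Summit.ValiantsHypothesis.ValiantsHypothesis.Theorems.DefinabilityGapMergeIsolation
open Summit.ValiantsHypothesis.ValiantsHypothesis.Theorems.DefinabilityGapClusterMerging

set_option linter.dupNamespace false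

namespace Summit.ValiantsHypothesis.ValiantsHypothesis.Theorems.DefinabilityGapForestSums

variable {m : ℕ}

/-! ## 1. Gates of child-multisets -/

/-- The gate of a multiset `E` of children under the parent map `par`: `Π_{x ∈ E} (z_x − z_{par x})`
(multiplicities = repeated factors). [this file] -/
def tprod (par : (Fin 3 → Fin (qOf m)) → (Fin 3 → Fin (qOf m))) (E : Multiset (Fin 3 → Fin (qOf m))) :
    MvPolynomial (Fin 3 → Fin (qOf m)) ℂ :=
  (E.map fun x => X x - X (par x)).prod

/-- Substituting into a gate factor by factor. [this file] -/
theorem bind₁_tprod (g : (Fin 3 → Fin (qOf m)) → MvPolynomial (Fin (qOf m) × Fin (qOf m)) ℂ)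
    (par : (Fin 3 → Fin (qOf m)) → (Fin 3 → Fin (qOf m))) (E : Multiset (Fin 3 → Fin (qOf m))) :
    bind₁ g (tprod par E) = (E.map fun x => g x - g (par x)).prod := by
  unfold tprod
  rw [map_multiset_prod, Multiset.map_map]
  refine congrArg Multiset.prod (Multiset.map_congr rfl fun x _ => ?_)
  show bind₁ g (X x - X (par x)) = g x - g (par x)
  rw [map_sub, bind₁_X_right, bind₁_X_right]

/-- STRIP at the multiset level: `μ ≤ count x E` copies of `x` split off. [this file] -/
theorem eq_replicate_add {E : Multiset (Fin 3 → Fin (qOf m))} {x : Fin 3 → Fin (qOf m)} {μ : ℕ}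
    (hμ : μ ≤ Multiset.count x E) :
    E = Multiset.replicate μ x +
      (Multiset.replicate (Multiset.count x E - μ) x + E.filter (fun y => ¬ y = x)) := by
  rw [← add_assoc, ← Multiset.replicate_add, Nat.add_sub_of_le hμ, ← Multiset.filter_eq' E x]
  exact (Multiset.filter_add_not (fun y => y = x) E).symm

/-- STRIP for gates: `tprod par E = (z_x − z_{par x})^μ · tprod par E'`. [this file] -/
theorem tprod_eq_pow_mul (par : (Fin 3 → Fin (qOf m)) → (Fin 3 → Fin (qOf m)))
    {E : Multiset (Fin 3 → Fin (qOf m))} {x : Fin 3 → Fin (qOf m)} {μ : ℕ} (hμ : μ ≤ Multiset.count x E) :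
    tprod par E = (X x - X (par x)) ^ μ *
      tprod par (Multiset.replicate (Multiset.count x E - μ) x + E.filter (fun y => ¬ y = x)) := by
  conv_lhs => rw [eq_replicate_add hμ]
  unfold tprod
  rw [Multiset.map_add, Multiset.prod_add, Multiset.map_replicate, Multiset.prod_replicate]

/-! ## 2. SURVIVE, KILL, TRANSFER, CONTRACT over general merge lists -/

/-- SURVIVE, one factor: two distinct live labels have distinct substituted polynomials, for every merge list whose
merged-away labels are pairwise distinct. [this file] -/
theorem wordPoly_wordL_ne' {L : List ((Fin 3 → Fin (qOf m)) × (Fin 3 → Fin (qOf m)))}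
    (hB : L.Pairwise fun p p' => p.2 ≠ p'.2) (hmL : 2 * 3 ^ L.length < m * m) {u v : Fin 3 → Fin (qOf m)}
    (huv : u ≠ v) (hu : ∀ p ∈ L, u ≠ p.2) (hv : ∀ p ∈ L, v ≠ p.2) :
    wordPoly m (wordL m L u) ≠ wordPoly m (wordL m L v) := by
  have hx : 1 ≤ 3 ^ L.length := Nat.one_le_pow _ _ (by norm_num)
  exact wordPoly_ne_of_differ_le (D := 3 ^ L.length - 1) (by omega) huv
    (Nat.le_sub_one_of_lt (card_differ_wordL_lt hB hu)) (Nat.le_sub_one_of_lt (card_differ_wordL_lt hB hv))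

/-- SURVIVE: a single gate of children on live labels survives `φ_L`. [this file] -/
theorem bind₁_wordL_tprod_ne_zero {L : List ((Fin 3 → Fin (qOf m)) × (Fin 3 → Fin (qOf m)))}
    (hB : L.Pairwise fun p p' => p.2 ≠ p'.2) (hmL : 2 * 3 ^ L.length < m * m)
    (par : (Fin 3 → Fin (qOf m)) → (Fin 3 → Fin (qOf m))) {E : Multiset (Fin 3 → Fin (qOf m))}
    (hE : ∀ x ∈ E, par x ≠ x ∧ (∀ p ∈ L, x ≠ p.2) ∧ ∀ p ∈ L, par x ≠ p.2) :
    bind₁ (fun c => wordPoly m (wordL m L c)) (tprod par E) ≠ 0 := by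
  intro h0
  rw [bind₁_tprod, Multiset.prod_eq_zero_iff, Multiset.mem_map] at h0
  obtain ⟨x, hx, h0⟩ := h0
  obtain ⟨hpx, hlx, hlp⟩ := hE x hx
  exact wordPoly_wordL_ne' hB hmL (Ne.symm hpx) hlx hlp (sub_eq_zero.1 h0)

/-- KILL: a gate containing the merged-away child of a merged pair `(par x, x) ∈ L` dies under `φ_L`. [this file] -/
theorem bind₁_wordL_tprod_eq_zero {L : List ((Fin 3 → Fin (qOf m)) × (Fin 3 → Fin (qOf m)))}
    (par : (Fin 3 → Fin (qOf m)) → (Fin 3 → Fin (qOf m))) {E : Multiset (Fin 3 → Fin (qOf m))}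
    {x : Fin 3 → Fin (qOf m)} (hp : (par x, x) ∈ L) (hx : x ∈ E) :
    bind₁ (fun c => wordPoly m (wordL m L c)) (tprod par E) = 0 := by
  rw [bind₁_tprod, Multiset.prod_eq_zero_iff, Multiset.mem_map]
  refine ⟨x, hx, ?_⟩
  have h : wordL m L x = wordL m L (par x) := wordL_snd_eq hp
  show wordPoly m (wordL m L x) - wordPoly m (wordL m L (par x)) = 0
  rw [h, sub_self]

/-- TRANSFER, one merge: `φ_{p :: L} D ≠ 0 ⟹ φ_L D ≠ 0` (`rename σ_p ∘ φ_L = φ_{p :: L}`). [this file] -/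
theorem bind₁_wordL_ne_zero_of_cons {L : List ((Fin 3 → Fin (qOf m)) × (Fin 3 → Fin (qOf m)))}
    (p : (Fin 3 → Fin (qOf m)) × (Fin 3 → Fin (qOf m))) {D : MvPolynomial (Fin 3 → Fin (qOf m)) ℂ}
    (h : bind₁ (fun c => wordPoly m (wordL m (p :: L) c)) D ≠ 0) :
    bind₁ (fun c => wordPoly m (wordL m L c)) D ≠ 0 := fun h0 =>
  h (by rw [← rename_mergeSub_bind₁_wordL L p D, h0, map_zero])

/-- CONTRACT: once `(par x₀, x₀)` is merged, the parent map may be contracted (`x₀ ↦ par x₀` as a parent) without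
changing `φ_L` of any gate. [this file] -/
theorem bind₁_wordL_tprod_congr {L : List ((Fin 3 → Fin (qOf m)) × (Fin 3 → Fin (qOf m)))}
    (par : (Fin 3 → Fin (qOf m)) → (Fin 3 → Fin (qOf m))) {x₀ : Fin 3 → Fin (qOf m)} (hp : (par x₀, x₀) ∈ L)
    (E : Multiset (Fin 3 → Fin (qOf m))) :
    bind₁ (fun c => wordPoly m (wordL m L c)) (tprod par E) =
      bind₁ (fun c => wordPoly m (wordL m L c))
        (tprod (fun y => if par y = x₀ then par x₀ else par y) E) := by
  rw [bind₁_tprod, bind₁_tprod]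
  refine congrArg Multiset.prod (Multiset.map_congr rfl fun y _ => ?_)
  show wordPoly m (wordL m L y) - wordPoly m (wordL m L (par y)) =
    wordPoly m (wordL m L y) - wordPoly m (wordL m L (if par y = x₀ then par x₀ else par y))
  by_cases h : par y = x₀
  · have h2 : wordL m L x₀ = wordL m L (par x₀) := wordL_snd_eq hp
    rw [if_pos h, h, h2]
  · rw [if_neg h]

/-! ## 3. The engine: induction on the number of gates, over all merge lists -/

/-- ENGINE. For every merge list `L` with pairwise distinct merged-away labels and `2·3^{|L|+j} < m²`: every sum of
`≤ j` pairwise distinct gates of children (w.r.t. `par`, `rk`) on live labels, with nonzero coefficients, survives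
`φ_L`. [this file] -/
theorem bind₁_wordL_forestSum_ne_zero {ι : Type*} (rk : (Fin 3 → Fin (qOf m)) → ℕ) (j : ℕ) :
    ∀ (L : List ((Fin 3 → Fin (qOf m)) × (Fin 3 → Fin (qOf m)))), (L.Pairwise fun p p' => p.2 ≠ p'.2) →
      2 * 3 ^ (L.length + j) < m * m →
      ∀ (par : (Fin 3 → Fin (qOf m)) → (Fin 3 → Fin (qOf m))) (I : Finset ι)
        (E : ι → Multiset (Fin 3 → Fin (qOf m))) (α : ι → ℂ), I.card ≤ j → I.Nonempty →
        (∀ i ∈ I, ∀ i' ∈ I, E i = E i' → i = i') → (∀ i ∈ I, α i ≠ 0) →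
        (∀ i ∈ I, ∀ x ∈ E i, rk (par x) < rk x ∧ (∀ p ∈ L, x ≠ p.2) ∧ ∀ p ∈ L, par x ≠ p.2) →
        bind₁ (fun c => wordPoly m (wordL m L c)) (∑ i ∈ I, C (α i) * tprod par (E i)) ≠ 0 := by
  induction j with
  | zero =>
    intro _ _ _ _ _ _ _ hI hne
    exact absurd hne.card_pos (not_lt.2 hI)
  | succ j ih =>
    intro L hB hm par I E α hI hne hinj hα hE
    have hpow : 3 ^ L.length ≤ 3 ^ (L.length + (j + 1)) :=
      Nat.pow_le_pow_right (by norm_num) (Nat.le_add_right _ _)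
    have hmL : 2 * 3 ^ L.length < m * m := by omega
    by_cases h2 : ∃ i₁ ∈ I, ∃ i₂ ∈ I, i₁ ≠ i₂
    · -- STEP
      obtain ⟨i₁, hi₁, i₂, hi₂, h12⟩ := h2
      have hE12 : E i₁ ≠ E i₂ := fun h => h12 (hinj i₁ hi₁ i₂ hi₂ h)
      obtain ⟨x₀, hx₀⟩ : ∃ x₀, ¬ Multiset.count x₀ (E i₁) = Multiset.count x₀ (E i₂) :=
        not_forall.1 fun h => hE12 (Multiset.ext.2 h)
      -- `x₀` is a child of some gate
      obtain ⟨i₃, hi₃, hx₀i₃⟩ : ∃ i ∈ I, x₀ ∈ E i := by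
        by_cases h : x₀ ∈ E i₁
        · exact ⟨i₁, hi₁, h⟩
        · refine ⟨i₂, hi₂, ?_⟩
          by_contra h'
          exact hx₀ (by rw [Multiset.count_eq_zero_of_notMem h, Multiset.count_eq_zero_of_notMem h'])
      obtain ⟨hr₀, hl₀, hlp₀⟩ := hE i₃ hi₃ x₀ hx₀i₃
      have hpx₀ : par x₀ ≠ x₀ := fun h => by rw [h] at hr₀; exact lt_irrefl _ hr₀
      -- TERM-RANK SELECTION: the minimum count `μ = count x₀ (E i₀)`
      obtain ⟨i₀, hi₀, hmin⟩ := I.exists_min_image (fun i => Multiset.count x₀ (E i)) ⟨i₁, hi₁⟩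
      have hmin' : ∀ i ∈ I, Multiset.count x₀ (E i₀) ≤ Multiset.count x₀ (E i) := fun i hi => hmin i hi
      -- STRIP
      obtain ⟨E', hE'⟩ : ∃ E' : ι → Multiset (Fin 3 → Fin (qOf m)), ∀ i, E' i =
          Multiset.replicate (Multiset.count x₀ (E i) - Multiset.count x₀ (E i₀)) x₀ +
            (E i).filter (fun y => ¬ y = x₀) :=
        ⟨fun i => Multiset.replicate (Multiset.count x₀ (E i) - Multiset.count x₀ (E i₀)) x₀ +
          (E i).filter (fun y => ¬ y = x₀), fun i => rfl⟩
      have hstrip : ∀ i ∈ I, E i = Multiset.replicate (Multiset.count x₀ (E i₀)) x₀ + E' i := fun i hi => by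
        rw [hE' i]; exact eq_replicate_add (hmin' i hi)
      have htp : ∀ i ∈ I, tprod par (E i) =
          (X x₀ - X (par x₀)) ^ Multiset.count x₀ (E i₀) * tprod par (E' i) := fun i hi => by
        rw [hE' i]; exact tprod_eq_pow_mul par (hmin' i hi)
      have hsum : ∑ i ∈ I, C (α i) * tprod par (E i) =
          (X x₀ - X (par x₀)) ^ Multiset.count x₀ (E i₀) * ∑ i ∈ I, C (α i) * tprod par (E' i) := by
        rw [Finset.mul_sum]
        exact Finset.sum_congr rfl fun i hi => by rw [htp i hi]; ring
      have hmemE : ∀ i ∈ I, ∀ y ∈ E' i, y ∈ E i := by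
        intro i hi y hy
        rw [hE' i, Multiset.mem_add, Multiset.mem_replicate, Multiset.mem_filter] at hy
        rcases hy with ⟨hn, hyx⟩ | ⟨hy, -⟩
        · rw [hyx]; exact Multiset.count_pos.1 (by omega)
        · exact hy
      -- the survivors `A` (count = μ) and the killed gates (count > μ)
      have hA0 : ∀ i ∈ I, Multiset.count x₀ (E i) = Multiset.count x₀ (E i₀) → x₀ ∉ E' i := by
        intro i _ hc
        rw [hE' i, Multiset.mem_add, Multiset.mem_replicate, Multiset.mem_filter]
        rintro (⟨hn, -⟩ | ⟨-, hne'⟩)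
        · exact hn (by omega)
        · exact hne' rfl
      have hB0 : ∀ i ∈ I, ¬ Multiset.count x₀ (E i) = Multiset.count x₀ (E i₀) → x₀ ∈ E' i := by
        intro i hi hc
        rw [hE' i, Multiset.mem_add, Multiset.mem_replicate]
        have := hmin' i hi
        exact Or.inl ⟨by omega, rfl⟩
      have hAI : ∀ i ∈ I.filter (fun i => Multiset.count x₀ (E i) = Multiset.count x₀ (E i₀)), i ∈ I :=
        fun i hi => (Finset.mem_filter.1 hi).1
      have hAc : ∀ i ∈ I.filter (fun i => Multiset.count x₀ (E i) = Multiset.count x₀ (E i₀)),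
          Multiset.count x₀ (E i) = Multiset.count x₀ (E i₀) := fun i hi => (Finset.mem_filter.1 hi).2
      have hAne : (I.filter (fun i => Multiset.count x₀ (E i) = Multiset.count x₀ (E i₀))).Nonempty :=
        ⟨i₀, Finset.mem_filter.2 ⟨hi₀, rfl⟩⟩
      have hAcard : (I.filter (fun i => Multiset.count x₀ (E i) = Multiset.count x₀ (E i₀))).card ≤ j := by
        have hss : I.filter (fun i => Multiset.count x₀ (E i) = Multiset.count x₀ (E i₀)) ⊂ I := by
          refine Finset.filter_ssubset.2 ?_
          by_cases hc1 : Multiset.count x₀ (E i₁) = Multiset.count x₀ (E i₀)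
          · exact ⟨i₂, hi₂, fun hc2 => hx₀ (hc1.trans hc2.symm)⟩
          · exact ⟨i₁, hi₁, hc1⟩
        have := Finset.card_lt_card hss
        omega
      -- MERGE `x₀ → par x₀`
      have hB' : ((par x₀, x₀) :: L).Pairwise fun p p' => p.2 ≠ p'.2 :=
        List.pairwise_cons.2 ⟨fun p' hp' => hl₀ p' hp', hB⟩
      have hm' : 2 * 3 ^ (((par x₀, x₀) :: L).length + j) < m * m := by
        rw [List.length_cons, show L.length + 1 + j = L.length + (j + 1) by omega]
        exact hm
      have hp : (par x₀, x₀) ∈ (par x₀, x₀) :: L := List.mem_cons_self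
      -- STRIP survives, TRANSFER to `φ_{L'}`
      rw [hsum, map_mul, map_pow]
      refine mul_ne_zero (pow_ne_zero _ ?_) (bind₁_wordL_ne_zero_of_cons (par x₀, x₀) ?_)
      · rw [map_sub, bind₁_X_right, bind₁_X_right]
        exact sub_ne_zero.2 (wordPoly_wordL_ne' hB hmL (Ne.symm hpx₀) hl₀ hlp₀)
      -- KILL outside `A`, CONTRACT on `A`
      have hkey : bind₁ (fun c => wordPoly m (wordL m ((par x₀, x₀) :: L) c))
            (∑ i ∈ I, C (α i) * tprod par (E' i)) =
          bind₁ (fun c => wordPoly m (wordL m ((par x₀, x₀) :: L) c))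
            (∑ i ∈ I.filter (fun i => Multiset.count x₀ (E i) = Multiset.count x₀ (E i₀)),
              C (α i) * tprod (fun y => if par y = x₀ then par x₀ else par y) (E' i)) := by
        rw [map_sum, map_sum, ← Finset.sum_filter_add_sum_filter_not I
          (fun i => Multiset.count x₀ (E i) = Multiset.count x₀ (E i₀)), Finset.sum_eq_zero
          (s := I.filter (fun i => ¬ Multiset.count x₀ (E i) = Multiset.count x₀ (E i₀))), add_zero]
        · refine Finset.sum_congr rfl fun i _ => ?_
          rw [map_mul, map_mul, bind₁_wordL_tprod_congr par hp (E' i)]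
        · intro i hi
          obtain ⟨hiI, hc⟩ := Finset.mem_filter.1 hi
          rw [map_mul, bind₁_wordL_tprod_eq_zero par hp (hB0 i hiI hc), mul_zero]
      rw [hkey]
      refine ih ((par x₀, x₀) :: L) hB' hm' (fun y => if par y = x₀ then par x₀ else par y)
        (I.filter (fun i => Multiset.count x₀ (E i) = Multiset.count x₀ (E i₀))) E' α hAcard hAne
        (fun i hi i' hi' h => hinj i (hAI i hi) i' (hAI i' hi')
          (by rw [hstrip i (hAI i hi), hstrip i' (hAI i' hi'), h]))
        (fun i hi => hα i (hAI i hi)) ?_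
      intro i hi y hy
      have hiI := hAI i hi
      have hyE : y ∈ E i := hmemE i hiI y hy
      have hyx : y ≠ x₀ := fun h => hA0 i hiI (hAc i hi) (by rw [← h]; exact hy)
      obtain ⟨hr, hl, hlp⟩ := hE i hiI y hyE
      refine ⟨?_, ?_, ?_⟩
      · show rk (if par y = x₀ then par x₀ else par y) < rk y
        by_cases h : par y = x₀
        · rw [if_pos h]; rw [h] at hr; exact hr₀.trans hr
        · rw [if_neg h]; exact hr
      · intro p hp'
        rcases List.mem_cons.1 hp' with rfl | hp'
        · exact hyx
        · exact hl p hp'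
      · intro p hp'
        show (if par y = x₀ then par x₀ else par y) ≠ p.2
        rcases List.mem_cons.1 hp' with rfl | hp'
        · by_cases h : par y = x₀
          · rw [if_pos h]; exact hpx₀
          · rw [if_neg h]; exact h
        · by_cases h : par y = x₀
          · rw [if_pos h]; exact hlp₀ p hp'
          · rw [if_neg h]; exact hlp p hp'
    · -- BASE: a single gate
      obtain ⟨i₀, hi₀⟩ := hne
      have hI1 : I = {i₀} := by
        refine Finset.eq_singleton_iff_unique_mem.2 ⟨hi₀, fun i hi => ?_⟩
        by_contra hne'
        exact h2 ⟨i, hi, i₀, hi₀, hne'⟩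
      rw [hI1, Finset.sum_singleton, map_mul, bind₁_C_right]
      refine mul_ne_zero (MvPolynomial.C_ne_zero.2 (hα i₀ hi₀)) (bind₁_wordL_tprod_ne_zero hB hmL par ?_)
      intro x hx
      obtain ⟨hr, hl, hlp⟩ := hE i₀ hi₀ x hx
      exact ⟨fun h => by rw [h] at hr; exact lt_irrefl _ hr, hl, hlp⟩

/-! ## 4. Forest sums under the planted map -/

/-- ★ ROOTED-FOREST MULTISET SUMS, every fan-in `k`: for ANY `par`, `rk`, every family of `≤ k` multisets of children
(`rk (par x) < rk x`) and all coefficients, `G_m` hits `Σ_E α_E · Π_{x ∈ E} (z_x − z_{par x})` unless it is `0`,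
as soon as `2·3^k < m²`. [this file] -/
theorem kiPer_hits_forestSums {k : ℕ} (hm : 2 * 3 ^ k < m * m)
    (par : (Fin 3 → Fin (qOf m)) → (Fin 3 → Fin (qOf m))) (rk : (Fin 3 → Fin (qOf m)) → ℕ)
    (𝓔 : Finset (Multiset (Fin 3 → Fin (qOf m)))) (hk : 𝓔.card ≤ k)
    (hE : ∀ E ∈ 𝓔, ∀ x ∈ E, rk (par x) < rk x) (α : Multiset (Fin 3 → Fin (qOf m)) → ℂ)
    (hf : ∑ E ∈ 𝓔, C (α E) * tprod par E ≠ 0) :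
    bind₁ (kiPer m) (∑ E ∈ 𝓔, C (α E) * tprod par E) ≠ 0 := by
  have hsum : ∑ E ∈ 𝓔, C (α E) * tprod par E = ∑ E ∈ 𝓔.filter (fun E => α E ≠ 0), C (α E) * tprod par E := by
    refine (Finset.sum_filter_of_ne fun E _ hne => ?_).symm
    intro h0
    apply hne
    rw [h0, C_0, zero_mul]
  have hne : (𝓔.filter (fun E => α E ≠ 0)).Nonempty := by
    by_contra h
    rw [Finset.not_nonempty_iff_eq_empty] at h
    exact hf (by rw [hsum, h, Finset.sum_empty])
  have hfun : kiPer m = fun c => wordPoly m (wordL m [] c) := funext fun c => kiPer_eq_wordPoly c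
  have hm' : 2 * 3 ^ (([] : List ((Fin 3 → Fin (qOf m)) × (Fin 3 → Fin (qOf m)))).length + k) < m * m := by
    rw [List.length_nil, Nat.zero_add]; exact hm
  rw [hsum, hfun]
  exact bind₁_wordL_forestSum_ne_zero rk k [] List.Pairwise.nil hm' par _ (fun E => E) α
    ((Finset.card_filter_le _ _).trans hk) hne (fun _ _ _ _ h => h) (fun E hE' => (Finset.mem_filter.1 hE').2)
    (fun E hE' x hx => ⟨hE E (Finset.mem_filter.1 hE').1 x hx, fun p hp => absurd hp List.not_mem_nil,
      fun p hp => absurd hp List.not_mem_nil⟩)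

/-- The same, «for every `k`, for all sufficiently large `m`». [this file] -/
theorem kiPer_hits_forestSums_eventually (k : ℕ) : ∃ m₀ : ℕ, ∀ m : ℕ, m₀ ≤ m →
    ∀ (par : (Fin 3 → Fin (qOf m)) → (Fin 3 → Fin (qOf m))) (rk : (Fin 3 → Fin (qOf m)) → ℕ)
      (𝓔 : Finset (Multiset (Fin 3 → Fin (qOf m)))), 𝓔.card ≤ k →
      (∀ E ∈ 𝓔, ∀ x ∈ E, rk (par x) < rk x) → ∀ (α : Multiset (Fin 3 → Fin (qOf m)) → ℂ),
      ∑ E ∈ 𝓔, C (α E) * tprod par E ≠ 0 → bind₁ (kiPer m) (∑ E ∈ 𝓔, C (α E) * tprod par E) ≠ 0 :=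
  ⟨2 * 3 ^ k + 1, fun m hm par rk 𝓔 hk hE α hf =>
    kiPer_hits_forestSums (Nat.lt_of_lt_of_le (Nat.lt_of_lt_of_le (Nat.lt_succ_self _) hm) (Nat.le_mul_self m))
      par rk 𝓔 hk hE α hf⟩

end Summit.ValiantsHypothesis.ValiantsHypothesis.Theorems.DefinabilityGapForestSums

end
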